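import Summits.CriticalPhenomena.PercolationContinuityZ3.Theorems.PercNearOneGluingNoHeavyQuantFarPendantTreeHair
import Summits.CriticalPhenomena.PercolationContinuityZ3.Theorems.PercNearOneGluingNoHeavyQuantFarPendantTreeStem
import HarnessLib

/-!
# QUANT lane R8, front "FAR beyond trees", layer one — PENDANT TREES IN ARBITRARY GRAPHS, III:
# **every finite weighted graph with a pendant subtree carrying two relays satisfies FAR at layer one**

builds on p205010 (kernel theorem, internal audit signed; external expert review pending)

Support file (`--supports stmt-CriticalPhenomena-4575`), seat `prim-quant-p1` (gen 24); memo
`run/shared/lean/prim/quant/prim-quant-p1-g24/FOR-LEAD-INTRINSIC.md` §6(a).  Standard axioms; no sorries; no definitions.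

THE THEOREM (`Block.layerOne_of_pendantTree`).  Let `w` be ANY weight function on the pairs of `Fin n`, `o` an observer, `A` a relay set.
Suppose a vertex set `Z` (`o, c ∉ Z`) hangs at a cut vertex `c` (`w` vanishes between `Z` and `(Z ∪ {c})ᶜ`) and is a TREE there (its
positive-weight pairs meeting `Z` are loops or parent pairs of a rooted tree with root `c`), and `A ∩ Z` contains two relays `a₀ ≠ a₁`,
`a₀` of least internal marginal `P(c ↔ a on Z)`.  Then the layer-one far-relay row holds at `o`:
`2 < Σ_{a∈A} P(o ↔ a)` and `P(o ↮ a) ≤ t` for all `a ∈ A` imply `P_w(#{a ∈ A : o ↔ a} ≤ 1) ≤ t`.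
NOTHING is assumed about the graph outside `Z` (it may be 2-connected, non-planar, anything): this extends FAR at layer one from trees
(`farRelayRow_tree_layerOne`, lead g8), unicyclic graphs and cacti (p1 g18–g22) to every graph with one pendant subtree holding two relays.
PROOF.  Sharp intrinsic criterion (`Block.real_card_le_one_le_sharp₂`, this seat) + its necessity lemmas fed by FAR on three auxiliary TREES
built inside `Fin n` (parts I–II): 'block alone' (heavy blocks, `M_in > 2`, then the exit lemma), 'block + hair' (light) and 'block + stem + hair'
(medium).  When fewer than two vertices lie off `Z ∪ {c}` the whole weight function is itself tree-supported and the tree theorem applies directly.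
* `Block.layerOne_of_pendantTree_spare` — the statement with the two spare vertices `u ≠ b ∉ Z ∪ {c}` explicit.
* `Block.layerOne_of_pendantTree` — the statement above.
[cite: Grimmett1999, §1.3 p. 10; §10.1] (product measure; percolation on trees); [cite: KozmaNitzan2024, Conjecture 3 (p. 15)] (FAR is the `j = 1`
far-relay row of the gluing programme); the theorems [this work].
-/

noncomputable section

namespace Summit.CriticalPhenomena.PercolationContinuityZ3.Theorems

namespace Quant

namespace Block

open Finset MeasureTheory Set
open Literature.Probability.LatticeModels
open Literature.Probability.Percolation
open Bundle (offZ avoid offZ_subset real_offZ_event_eq_of_agree)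
open scoped Classical

variable {n : ℕ} {o c : Fin n} {Z : Finset (Fin n)}

/-- **PENDANT TREES ARE GOOD AT LAYER ONE, IN EVERY GRAPH (two spare vertices given).**  `w` hangs a block on `Z` at `c` (`o, c ∉ Z`);
the positive-weight pairs meeting `Z` are parent pairs of a rooted tree (`par`, `dep`, root `c`: depth-`0` vertices have parent `c`, deeper
ones a parent in `Z` one level up); `A ∩ Z` contains `a₀ ≠ a₁` with `τ₀ = P(c ↔ a₀ on Z)` least among the internal marginals of `A ∩ Z`;
`u ≠ b` are two vertices off `Z ∪ {c}`.  Then the layer-one FAR instance holds at `o`: `2 < Σ_{a∈A} P(o ↔ a)` and `P(o ↮ a) ≤ t` on `A` imply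
`P_w(#{a ∈ A : o ↔ a} ≤ 1) ≤ t` — whatever the rest of the graph is.  PROOF: heavy block (`M_in > 2`): FAR on the tree `Z ∪ {c}` alone
(`blockAlone_ineq_of_pendantTree`) gives `t_S ≥ τ₀`, exit lemma; `M_in ≤ 2`: FAR on the trees 'block + hair' / 'block + stem + hair'
(`oneHair_ineq_of_pendantTree`, `stemHair_ineq_of_pendantTree`) gives (B2♯) by `sharp_light_of_oneHair` / `sharp_medium_of_stemHair`,
then `real_card_le_one_le_sharp₂`. [this work] -/
theorem layerOne_of_pendantTree_spare (w : Sym2 (Fin n) → unitInterval) (ho : o ∉ Z) (hc : c ∉ Z)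
    (hw : ∀ x y : Fin n, x ≠ y → x ∈ Z → y ∉ Z → y ≠ c → (w s(x, y) : ℝ) = 0)
    (par : Fin n → Fin n) (dep : Fin n → ℕ)
    (hpar0 : ∀ z ∈ Z, dep z = 0 → par z = c)
    (hparS : ∀ z ∈ Z, dep z ≠ 0 → par z ∈ Z ∧ dep (par z) + 1 = dep z)
    (hsuppZ : ∀ e : Sym2 (Fin n), e ∉ avoid Z → w e ≠ 0 → e.IsDiag ∨ ∃ z ∈ Z, e = s(par z, z))
    {u b : Fin n} (huZ : u ∉ Z) (huc : u ≠ c) (hbZ : b ∉ Z) (hbc : b ≠ c) (hub : u ≠ b)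
    (A : Finset (Fin n)) (t : ℝ) {a₀ a₁ : Fin n} (ha₀ : a₀ ∈ A ∩ Z) (ha₁ : a₁ ∈ A ∩ Z) (hne : a₀ ≠ a₁)
    (hmin : ∀ a ∈ A ∩ Z, (prodBernoulli w).real {ω | onZ Z ω ∈ openConn c a₀} ≤ (prodBernoulli w).real {ω | onZ Z ω ∈ openConn c a})
    (hEN : (2 : ℝ) < ∑ a ∈ A, (prodBernoulli w).real (openConn o a))
    (hcut : ∀ a ∈ A, (prodBernoulli w).real (openConn o a)ᶜ ≤ t) :
    (prodBernoulli w).real {ω : BondConfig (Fin n) | (A.filter fun a => ω ∈ openConn o a).card ≤ 1} ≤ t := by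
  set μ := prodBernoulli w with hμ
  set τ₀ := μ.real {ω | onZ Z ω ∈ openConn c a₀} with hτ₀
  set M := ∑ a ∈ A ∩ Z, μ.real {ω | onZ Z ω ∈ openConn c a} with hMdef
  set hS := μ.real {ω | 1 ≤ ((A ∩ Z).filter fun a => onZ Z ω ∈ openConn c a).card} with hhS
  set tS := μ.real {ω | 2 ≤ ((A ∩ Z).filter fun a => onZ Z ω ∈ openConn c a).card} with htS
  by_cases hM : M ≤ 2
  · have htShS : tS ≤ hS := by
      refine measureReal_mono (fun ω hω => ?_) (measure_ne_top _ _)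
      simp only [mem_setOf_eq] at hω ⊢; omega
    have hτh : τ₀ ≤ hS := by
      refine measureReal_mono (fun ω hω => ?_) (measure_ne_top _ _)
      simp only [mem_setOf_eq] at hω ⊢
      exact Finset.card_pos.2 ⟨a₀, Finset.mem_filter.2 ⟨ha₀, hω⟩⟩
    have hτ0 : 0 ≤ τ₀ := measureReal_nonneg
    have hτ1 : τ₀ ≤ 1 := measureReal_le_one
    have hB2l : M + τ₀ ≤ 2 → τ₀ - tS ≤ (hS - tS) * (2 - M) := by
      intro hl
      refine sharp_light_of_oneHair (by linarith) (by linarith) hl fun p hp hp1 => ?_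
      have hp0 : 0 ≤ p := by linarith
      have := oneHair_ineq_of_pendantTree w hc hw par dep hpar0 hparS hsuppZ hbZ hbc A hmin hp0 hp1 (by linarith)
      linarith
    have hB2m : 2 < M + τ₀ → (τ₀ - tS) * (M + τ₀) ≤ 2 * (hS - tS) * τ₀ := by
      intro hm
      have := sharp_medium_of_stemHair (s := hS - tS) (t := tS) (by linarith) hτ0 hτ1 hm fun g p hg0 hg1 hp0 hp1 hE => by
        have := stemHair_ineq_of_pendantTree w hc hw par dep hpar0 hparS hsuppZ huZ huc hbZ hbc hub A hmin hg0 hg1 hp0 hp1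
          (by linarith)
        linarith
      linarith
    exact real_card_le_one_le_sharp₂ w ho hc hw A t ha₀ ha₁ hne (hmin a₁ ha₁) hcut hEN hM hB2l hB2m
  · have hM' : 2 < M := lt_of_not_ge hM
    have hexit := blockAlone_ineq_of_pendantTree w hc hw par dep hpar0 hparS hsuppZ A hmin hM'
    exact real_card_le_one_le_of_exit w ho hc hw A t ha₀ (hcut a₀ (Finset.mem_inter.1 ha₀).1) hexit

/-- **PENDANT TREES ARE GOOD AT LAYER ONE, IN EVERY GRAPH.**  As `layerOne_of_pendantTree_spare` without the spare vertices: if fewer than two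
vertices lie off `Z ∪ {c}` the whole weight function is tree-supported (the block, `c`, and at most the observer) and `farRelayRow_tree_layerOne`
applies directly.  So: a finite weighted graph with a pendant subtree (hanging at a cut vertex `c`, observer outside) that carries two relays
satisfies the `j = 1` instance of `Quant.FarRelayRow` — no hypothesis on the rest of the graph. [this work] -/
theorem layerOne_of_pendantTree (w : Sym2 (Fin n) → unitInterval) (ho : o ∉ Z) (hc : c ∉ Z)
    (hw : ∀ x y : Fin n, x ≠ y → x ∈ Z → y ∉ Z → y ≠ c → (w s(x, y) : ℝ) = 0)
    (par : Fin n → Fin n) (dep : Fin n → ℕ)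
    (hpar0 : ∀ z ∈ Z, dep z = 0 → par z = c)
    (hparS : ∀ z ∈ Z, dep z ≠ 0 → par z ∈ Z ∧ dep (par z) + 1 = dep z)
    (hsuppZ : ∀ e : Sym2 (Fin n), e ∉ avoid Z → w e ≠ 0 → e.IsDiag ∨ ∃ z ∈ Z, e = s(par z, z))
    (A : Finset (Fin n)) (t : ℝ) {a₀ a₁ : Fin n} (ha₀ : a₀ ∈ A ∩ Z) (ha₁ : a₁ ∈ A ∩ Z) (hne : a₀ ≠ a₁)
    (hmin : ∀ a ∈ A ∩ Z, (prodBernoulli w).real {ω | onZ Z ω ∈ openConn c a₀} ≤ (prodBernoulli w).real {ω | onZ Z ω ∈ openConn c a})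
    (hEN : (2 : ℝ) < ∑ a ∈ A, (prodBernoulli w).real (openConn o a))
    (hcut : ∀ a ∈ A, (prodBernoulli w).real (openConn o a)ᶜ ≤ t) :
    (prodBernoulli w).real {ω : BondConfig (Fin n) | (A.filter fun a => ω ∈ openConn o a).card ≤ 1} ≤ t := by
  by_cases hsp : ∃ u b : Fin n, u ∉ Z ∧ u ≠ c ∧ b ∉ Z ∧ b ≠ c ∧ u ≠ b
  · obtain ⟨u, b, huZ, huc, hbZ, hbc, hub⟩ := hsp
    exact layerOne_of_pendantTree_spare w ho hc hw par dep hpar0 hparS hsuppZ huZ huc hbZ hbc hub A t ha₀ ha₁ hne hmin hEN hcut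
  · -- at most one vertex off `Z ∪ {c}`: the whole graph is a tree rooted at `o`
    have hone : ∀ x y : Fin n, x ∉ Z → x ≠ c → y ∉ Z → y ≠ c → x = y := by
      intro x y hx hxc hy hyc
      by_contra hxy
      exact hsp ⟨x, y, hx, hxc, hy, hyc, hxy⟩
    have hmem_avoid : ∀ x y : Fin n, s(x, y) ∈ avoid Z ↔ x ∉ Z ∧ y ∉ Z := by
      intro x y
      rw [Bundle.avoid, Finset.mem_filter]
      constructor
      · intro h; exact ⟨fun hx => h.2 x hx (Sym2.mem_mk_left _ _), fun hy => h.2 y hy (Sym2.mem_mk_right _ _)⟩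
      · rintro ⟨hx, hy⟩
        refine ⟨Finset.mem_univ _, fun z hz hzm => ?_⟩
        rcases Sym2.mem_iff.1 hzm with rfl | rfl
        · exact hx hz
        · exact hy hz
    by_cases hoc : o = c
    · -- root `c = o`
      subst hoc
      set par' : Fin n → Fin n := fun x => if x ∈ Z then par x else o with hpar'
      set dep' : Fin n → ℕ := fun x => if x ∈ Z then dep x else 0 with hdep'
      have hroot' : ∀ x, x ≠ o → dep' x = 0 → par' x = o := by
        intro x _ hx0
        by_cases hxZ : x ∈ Z
        · have : dep x = 0 := by simpa [hdep', hxZ] using hx0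
          simp only [hpar', hxZ, if_true]; exact hpar0 x hxZ this
        · simp only [hpar', hxZ, if_false]
      have hstep' : ∀ x, x ≠ o → dep' x ≠ 0 → par' x ≠ o ∧ dep' (par' x) + 1 = dep' x := by
        intro x _ hx0
        by_cases hxZ : x ∈ Z
        · have hd : dep x ≠ 0 := by simpa [hdep', hxZ] using hx0
          obtain ⟨hpZ, hpd⟩ := hparS x hxZ hd
          refine ⟨?_, ?_⟩
          · simp only [hpar', hxZ, if_true]; exact fun h => hc (h ▸ hpZ)
          · simp only [hpar', hdep', hxZ, if_true, hpZ]; exact hpd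
        · exact absurd (by simp [hdep', hxZ]) hx0
      have hsupp' : ∀ e, w e ≠ 0 → e.IsDiag ∨ ∃ x, x ≠ o ∧ e = s(par' x, x) := by
        intro e he
        by_cases hea : e ∈ avoid Z
        · induction e using Sym2.ind with
          | h x y =>
            obtain ⟨hx, hy⟩ := (hmem_avoid x y).1 hea
            by_cases hxc : x = o
            · by_cases hyc : y = o
              · left; subst hxc; subst hyc; exact Sym2.mk_isDiag_iff.2 rfl
              · right; refine ⟨y, hyc, ?_⟩; simp only [hpar', hy, if_false]; rw [hxc]
            · by_cases hyc : y = o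
              · right; refine ⟨x, hxc, ?_⟩; simp only [hpar', hx, if_false]; rw [hyc, Sym2.eq_swap]
              · left; rw [hone x y hx hxc hy hyc]; exact Sym2.mk_isDiag_iff.2 rfl
        · rcases hsuppZ e hea he with hd | ⟨z, hz, rfl⟩
          · exact Or.inl hd
          · right; refine ⟨z, fun h => hc (h ▸ hz), ?_⟩; simp only [hpar', hz, if_true]
      exact farRelayRow_tree_layerOne n w o dep' par' hroot' hstep' hsupp' A t hEN hcut
    · -- root `o ≠ c`: `c` hangs under `o`, the block under `c`
      set par' : Fin n → Fin n := fun x => if x ∈ Z then par x else o with hpar'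
      set dep' : Fin n → ℕ := fun x => if x ∈ Z then dep x + 1 else 0 with hdep'
      have hroot' : ∀ x, x ≠ o → dep' x = 0 → par' x = o := by
        intro x _ hx0
        by_cases hxZ : x ∈ Z
        · exfalso; simp [hdep', hxZ] at hx0
        · simp only [hpar', hxZ, if_false]
      have hstep' : ∀ x, x ≠ o → dep' x ≠ 0 → par' x ≠ o ∧ dep' (par' x) + 1 = dep' x := by
        intro x _ hx0
        by_cases hxZ : x ∈ Z
        · by_cases hd : dep x = 0
          · have hpc : par x = c := hpar0 x hxZ hd
            refine ⟨?_, ?_⟩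
            · simp only [hpar', hxZ, if_true, hpc]; exact fun h => hoc h.symm
            · simp only [hpar', hdep', hxZ, if_true, hpc, hc, if_false, hd]
          · obtain ⟨hpZ, hpd⟩ := hparS x hxZ hd
            refine ⟨?_, ?_⟩
            · simp only [hpar', hxZ, if_true]; exact fun h => ho (h ▸ hpZ)
            · simp only [hpar', hdep', hxZ, if_true, hpZ]; omega
        · exact absurd (by simp [hdep', hxZ]) hx0
      have hsupp' : ∀ e, w e ≠ 0 → e.IsDiag ∨ ∃ x, x ≠ o ∧ e = s(par' x, x) := by
        intro e he
        by_cases hea : e ∈ avoid Z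
        · induction e using Sym2.ind with
          | h x y =>
            obtain ⟨hx, hy⟩ := (hmem_avoid x y).1 hea
            -- each of `x, y` is `c` or `o`
            have hxco : x = c ∨ x = o := by
              by_cases hxc : x = c
              · exact Or.inl hxc
              · exact Or.inr (hone x o hx hxc ho hoc)
            have hyco : y = c ∨ y = o := by
              by_cases hyc : y = c
              · exact Or.inl hyc
              · exact Or.inr (hone y o hy hyc ho hoc)
            rcases hxco with rfl | rfl <;> rcases hyco with rfl | rfl
            · left; exact Sym2.mk_isDiag_iff.2 rfl
            · right; refine ⟨x, fun h => hoc h.symm, ?_⟩; simp only [hpar', hc, if_false]; rw [Sym2.eq_swap]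
            · right; refine ⟨y, fun h => hoc h.symm, ?_⟩; simp only [hpar', hc, if_false]
            · left; exact Sym2.mk_isDiag_iff.2 rfl
        · rcases hsuppZ e hea he with hd | ⟨z, hz, rfl⟩
          · exact Or.inl hd
          · right; refine ⟨z, fun h => ho (h ▸ hz), ?_⟩; simp only [hpar', hz, if_true]
      exact farRelayRow_tree_layerOne n w o dep' par' hroot' hstep' hsupp' A t hEN hcut

end Block
end Quant
end Summit.CriticalPhenomena.PercolationContinuityZ3.Theorems
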